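import Summits.QuantumFields.YangMills.Theorems.BalabanUVNodesN14RecordCensus
import Summits.QuantumFields.YangMills.Theorems.BalabanUVNodesRateCarriersOfRecord11

/-!
# DAG node N14 · NE1′ — THE K4 STUB `YMDAG.UVSplit.S_N14` AT THE RATE-RECORD HOME OF RECORD, Stage 11 (2026-08-26): (§1) the DATUM-KEYED faces, read at
# NODE 00's CANONICAL parameter of the datum (`Node00/Record11DatumKey`, node00-def-RR-2, p455304 — the key of record for BOTH carrier records of clusters K4 ∕ K5,
# dag-lead WORDS-101 (ii)), for ANY carrier map `rc`; (§2) BY NAME at layer B's `YMDAG.UVSplit.RRec₁₁ 𝔯` (`Thm/BalabanUVNodesRateCarriersOfRecord11`, dag-n22-e,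
# p457330): the KNIT OF THE ROW from the dressing estimate for the reading's dressed-tower assignment `𝔯.ne1`, its slot form, its independence from `𝔯.lit`, the
# record census' regression test at the home with both ends of the residual design, N19's final-scale profile there, and the `canon₁₁` reading

Cell `pub-ymgap`, YM-PLAN Track A (HUMAN RULING D-0062), R134 acceleration seat `pub-ymgap-dag-n14-d` (strategy s2: «knit `s_N14_of_uniformLeaves` ∕ `_of_refines`
at `RRec` ₁₁, or flag `not_s_N14_of_admits`»), generation 2 — the successor module announced in g0's HANDOFF (trigger (t1): the rate-record home lands; it did:
layer A `Node00/RateRecord11` p455395, key `Node00/Record11DatumKey` p455304, layer B `BalabanUVNodesRateCarriersOfRecord11` p457330, all 2026-08-26).  THEOREMS ONLY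
(0 `def`, 0 `sorry`, standard axioms); imports g0's record census `BalabanUVNodesN14RecordCensus` (p451675 ∕ p453609; through it n14-a's closer of record
`BalabanUVNodesN14AtRecord` p419066, the K4 module `BalabanUVNodesSpineRates` and the NE1′ owner lineage's `Spine/NE1p/DressedRootStrict`) and layer B (through it
layer A and the key); modifies nothing; every cited lemma is used BY NAME.  `--supports stmt-QuantumFields-19676` (K3 `SpineGivenEndpointR11`).

THE SITUATION.  Layer B types the rate-record predicate of record `RRec₁₁ 𝔯 : RateRecordPred N` over a READING `𝔯 : RateReading₁₁ N` = ⟨`lit` (RR-1's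
Literature-typed rate objects per `(F, θ, g₀, os)`), `ne1 : (F) → Stage11Params F N → (ℕ → ℝ) → List (ULoop F) → NE1pCarriers` (N14's dressed-tower carriers,
Summits-typed)⟩: at `(F, D, g₀, os)` it admits exactly the bundles `rateCarriersOfRecord₁₁ 𝔯 F h.params g₀ os k = ⟨𝔯.ne1 F h.params g₀ os, ne2OfRecord₁₁ …,
ne3OfRecord₁₁ F …, u3OfRecord₁₁ h.params … k⟩` of every run length `k`, read at the CANONICAL parameter `h.params` of the datum of record
(`h : Node00.IsDatumOfRecord₁₁C F N D`, `.provisos`, `.admissible`, `.eq_datumOfRecord₁₁`).  Both assignments are RESIDUAL (layer B's honest framing): the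
dressed tower OF RECORD — NODE O's object, the bookings of the observable-attached terms of Bałaban's run at `(θ, g₀, os)` — is not in the tree.  N14's K4 stub
`S_N14 RRec := ∀ F D g₀ os R, RRec F D g₀ os R → N14At R.ne1` (`N14At c := DressedStabilityStrict c.𝒯 c.Λ`) reads `R.ne1` ONLY, and layer B's own face
`s_N14_rRec₁₁_iff` says `S_N14 (RRec₁₁ 𝔯) ↔ ∀ F D (h : IsDatumOfRecord₁₁C F N D) g₀ os, N14At (𝔯.ne1 F h.params g₀ os)`.  This file supplies the row's KNIT at
that face and the census of what the stub is at the home.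

WHAT IS PROVED.
* §1 (generic in a carrier map `rc : (F) → (θ : Stage11Params F N) → θ.Provisos₁₁ → Λ' F → (ℕ → ℝ) → List (ULoop F) → RateCarriers N` and the binder type `Λ'`;
  layer B is the instance `Λ' F := ℕ`, `rc F θ _ k g₀ os := rateCarriersOfRecord₁₁ 𝔯 F θ g₀ os k` — **`rRec₁₁_iff_datumKey`**, `Iff.rfl`): **`s_N14_datumKey_iff`**
  — at the home «`∃ (h : IsDatumOfRecord₁₁C F N D) ℓ, R = rc F h.params h.provisos ℓ g₀ os`» the stub IS «NE1′ at `(rc F h.params h.provisos ℓ g₀ os).ne1` for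
  every datum of record» (`Iff`); **`s_N14_datumKey_of_n14At`** ∕ **`_of_uniformLeaves`** — THE θ-SUFFICIENT KNIT: the dressing estimate (resp. the uniform-leaves
  slot, END-B via n14-a's `n14At_of_uniformLeaves`) at EVERY admissible parameter with provisos gives the stub; **`rrec_thetaKey_canon_iff_datumKey`** (`Iff`) —
  the datum-keyed home IS g0's θ-keyed home (record census §5) with the carrier map CANONICALISED, `R = Node00.canon₁₁ F N (rc F) θ hP ℓ g₀ os` (RR-2's
  `Node00.exists_keyed_canon₁₁_iff` at `Φ x := R = x ℓ g₀ os` — the coherence sentence, instantiated for the RATE record); **`s_R00x_datumKey`** — K4's existence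
  stub `S_R00x Rec₁₁C` closes BY THE HOME ITSELF for any `rc` with inhabited binder types (nothing of N14 sits in `S_R00x`); **`not_s_N14_datumKey_of_hits_growing`**
  — the census' §1 regression test at the home (a carrier map whose `ne1` takes the doubling-tower value `⟨Unit, growingTower, 1⟩` at one datum of record refutes
  the stub — dag-ref-F READ #7's typing guard for the K3 assembly, in kernel at the key of record); **`finalProfile_at_datumKey`** — N19's face (`finalProfile_of_n14`).
* §2 (BY NAME at `RRec₁₁ 𝔯`, on layer B's `s_N14_rRec₁₁_iff`): **`s_N14_rRec₁₁_of_n14At`** — THE KNIT OF THE ROW: the dressing estimate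
  `∀ F θ, θ.Provisos₁₁ → θ.Admissible → ∀ g₀ os, N14At (𝔯.ne1 F θ g₀ os)` (n14-c's s1 target type for the reading's assignment) gives `S_N14 (RRec₁₁ 𝔯)`;
  **`s_N14_rRec₁₁_of_uniformLeaves`** ∕ **`s_N14_rRec₁₁_of_one`** — the same from the slot (ONE application of `n14At_of_uniformLeaves`; END-B
  `dressedStabilityStrict_of_bookingLeaves` by name), resp. from ONE `U : UniformConstants` serving every admissible parameter; **`s_N14_rRec₁₁_iff_of_ne1_eq`** —
  the stub does not read `𝔯.lit` (nothing of node U3 ∕ N16 ∕ N15 bears on N14 at the home); **`not_s_N14_rRec₁₁_of_hits_growing`** ∕ **`not_s_N14_rRec₁₁_growing`** ∕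
  **`…_of_isRecordOfRecord₁₁C`** — the test: a reading whose `ne1` hits the doubling tower at one datum of record (e.g. the CONSTANT doubling assignment, given any datum
  ∕ record of record — K0 at `N = 2`) has NO `S_N14`, while **`s_N14_rRec₁₁_toy`** — the constant TOY assignment closes it with no content; **`s_N14_rRec₁₁_depends_on_ne1`**
  — both at once: given one datum of record the stub is a statement ABOUT `𝔯.ne1`, decided by nothing in the home; **`finalProfile_at_rRec₁₁`** ∕
  **`dressedStability_at_rRec₁₁`** — N19's final-scale profile and the weak headline for `𝔯.ne1`'s tower at the canonical parameter; **`n14At_canon_of_s_N14_rRec₁₁`**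
  — at an admissible `θ` the stub gives NE1′ for `𝔯.ne1` read through `Node00.canon₁₁`; **`ratesAt_rateCarriersOfRecord₁₁_n14`** — the N14 conjunct of K4's `RatesAt`
  at the home's bundle of ANY run length is `N14At (𝔯.ne1 F h.params g₀ os)` (level-free).  n14-a's record faces `finalProfile_at_record` ∕ `sizeBinder_dressed_at_record`
  ∕ `oldInfluenceBudget_at_record` (`BalabanUVNodesN14AtRecord` §4) are generic in `RRec` and apply at `RRec := RRec₁₁ 𝔯` verbatim — not restated.

HONEST FRAMING.  Count-neutral kernel bookkeeping: one-application knits and `Iff`-unfoldings over a RESIDUAL dressed-tower assignment `𝔯.ne1`; a skeleton quoting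
`S_N14 (RRec₁₁ 𝔯)` NAMES its `𝔯.ne1`, and the stub is contentful exactly for `𝔯.ne1` = the dressed tower OF RECORD (absent), junk-true for the toy assignment, false
for the doubling one (§2, in kernel); N14 NOT discharged (typed 28∕28 · discharged 5∕28 unmoved); NE1′ is NOT PRINTED ([Balaban1989LargeFieldII] (1.73)–(1.75)
pp. 379–380 type the action only) and NOT PROVED; nothing of Bałaban's is asserted or denied at his objects — the refuting ∕ inhabiting assignments are DEGENERATE
probes of the typing (toy and doubling towers).  One finite four-torus programme at fixed `ε` — NOT infinite volume, NOT OS on ℝ⁴, NOT a mass gap, NOT Clay.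
-/

noncomputable section



namespace YMDAG.N14

open Literature.MathematicalPhysics.QuantumFieldTheory.Balaban1983to89
open Literature.MathematicalPhysics.QuantumFieldTheory.Balaban1983to89.T4Continuum
open Summit.QuantumFields.BalabanUV.T4Continuum.NE1p.DressedRoot
open YMDAG.UVSplit

variable {N : ℕ} [NeZero N]

/-! ## §1 THE DATUM-KEYED HOME «`∃ h : IsDatumOfRecord₁₁C F N D, ∃ ℓ, R = rc F h.params h.provisos ℓ g₀ os`» — N14's faces for ANY carrier map `rc` read at
NODE 00's CANONICAL parameter of the datum (the key of record, dag-lead WORDS-101 (ii)); generic in the binder type `Λ'` (layer B: `Λ' F := ℕ`, the level) -/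

section DatumKeyed

variable {Λ' : T4Family → Type*}
variable (rc : ∀ (F : T4Family) (θ : Node00.Stage11Params F N), θ.Provisos₁₁ → Λ' F → (ℕ → ℝ) → List (ULoop F) → RateCarriers N)

/-- **WHAT `S_N14` SAYS AT A DATUM-KEYED HOME** (`Iff`): NE1′ at `(rc F h.params h.provisos ℓ g₀ os).ne1` for every datum of record `D` (key `h`), every binder,
tuned sequence and loop string — the stub IS the dressing estimate for the carrier map's `ne1` OBJECT read at the canonical parameter. [folklore] -/
theorem s_N14_datumKey_iff :
    S_N14 (fun F D g₀ os R => ∃ (h : Node00.IsDatumOfRecord₁₁C F N D) (ℓ : Λ' F), R = rc F h.params h.provisos ℓ g₀ os) ↔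
      ∀ (F : T4Family) (D : Datum F N) (h : Node00.IsDatumOfRecord₁₁C F N D) (ℓ : Λ' F) (g₀ : ℕ → ℝ) (os : List (ULoop F)),
        N14At (rc F h.params h.provisos ℓ g₀ os).ne1 :=
  ⟨fun hS F D h ℓ g₀ os => hS F D g₀ os _ ⟨h, ℓ, rfl⟩, fun hS F D g₀ os _ ⟨h, ℓ, hR⟩ => hR ▸ hS F D h ℓ g₀ os⟩

/-- **THE θ-SUFFICIENT FORM** [bookkeeping]: the dressing estimate at EVERY admissible Stage-11 parameter with provisos (what a producer proves; n14-c's s1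
currency `N14At`) gives `S_N14` at the datum-keyed home — read at the canonical parameter via `IsDatumOfRecord₁₁C.admissible`. [folklore] -/
theorem s_N14_datumKey_of_n14At
    (h : ∀ (F : T4Family) (θ : Node00.Stage11Params F N) (hP : θ.Provisos₁₁) (ℓ : Λ' F), θ.Admissible →
      ∀ (g₀ : ℕ → ℝ) (os : List (ULoop F)), N14At (rc F θ hP ℓ g₀ os).ne1) :
    S_N14 (fun F D g₀ os R => ∃ (h : Node00.IsDatumOfRecord₁₁C F N D) (ℓ : Λ' F), R = rc F h.params h.provisos ℓ g₀ os) :=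
  (s_N14_datumKey_iff rc).2 fun _ _ hD ℓ g₀ os => h _ hD.params hD.provisos ℓ hD.admissible g₀ os

/-- … or from the SLOT at the object: uniform leaves at its own rate at every admissible parameter (END-B via n14-a's `n14At_of_uniformLeaves`). [folklore] -/
theorem s_N14_datumKey_of_uniformLeaves
    (h : ∀ (F : T4Family) (θ : Node00.Stage11Params F N) (hP : θ.Provisos₁₁) (ℓ : Λ' F), θ.Admissible →
      ∀ (g₀ : ℕ → ℝ) (os : List (ULoop F)), ∃ U : UniformConstants, U.Λ = (rc F θ hP ℓ g₀ os).ne1.Λ ∧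
        ∀ p K, Nonempty (BookingLeaves U ((rc F θ hP ℓ g₀ os).ne1.𝒯.B p K) ((rc F θ hP ℓ g₀ os).ne1.𝒯.T p K))) :
    S_N14 (fun F D g₀ os R => ∃ (h : Node00.IsDatumOfRecord₁₁C F N D) (ℓ : Λ' F), R = rc F h.params h.provisos ℓ g₀ os) :=
  s_N14_datumKey_of_n14At rc fun F θ hP ℓ hθ g₀ os => n14At_of_uniformLeaves _ (h F θ hP ℓ hθ g₀ os)

/-- **THE DATUM-KEYED HOME IS THE θ-KEYED ONE READ THROUGH `Node00.canon₁₁`** (`Iff`, by `Node00.exists_keyed_canon₁₁_iff`): RR-2's coherence sentence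
instantiated for the rate record — so the θ-keyed faces of `BalabanUVNodesN14RecordCensus` §5 and the faces here are about the SAME predicate once the carrier
map is canonicalised. [folklore] -/
theorem rrec_thetaKey_canon_iff_datumKey {F : T4Family} (D : Datum F N) (g₀ : ℕ → ℝ) (os : List (ULoop F)) (R : RateCarriers N) :
    (∃ (θ : Node00.Stage11Params F N) (hP : θ.Provisos₁₁) (ℓ : Λ' F), θ.Admissible ∧ D = Node00.datumOfRecord₁₁ F N θ hP ∧
        R = Node00.canon₁₁ F N (rc F) θ hP ℓ g₀ os) ↔
      ∃ (h : Node00.IsDatumOfRecord₁₁C F N D) (ℓ : Λ' F), R = rc F h.params h.provisos ℓ g₀ os := by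
  constructor
  · rintro ⟨θ, hP, ℓ, hθ, hD, hR⟩
    obtain ⟨h, hh⟩ := (Node00.exists_keyed_canon₁₁_iff (f := rc F) (fun x => R = x ℓ g₀ os)).1 ⟨θ, hP, hθ, hD, hR⟩
    exact ⟨h, ℓ, hh⟩
  · rintro ⟨h, ℓ, hR⟩
    obtain ⟨θ, hP, hθ, hD, hh⟩ := (Node00.exists_keyed_canon₁₁_iff (f := rc F) (fun x => R = x ℓ g₀ os)).2 ⟨h, hR⟩
    exact ⟨θ, hP, ℓ, hθ, hD, hh⟩

/-- **K4's EXISTENCE STUB CLOSES BY THE DATUM-KEYED HOME ITSELF, for ANY carrier map with inhabited binders** (`isDatumOfRecord₁₁C_of_isRecordOfRecord₁₁C` +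
`ForSmallCouplings.of_forall`) — nothing of N14 sits in `S_R00x`. [folklore] -/
theorem s_R00x_datumKey (hℓ : ∀ F : T4Family, Nonempty (Λ' F)) :
    S_R00x (fun F D w => Node00.IsRecordOfRecord₁₁C F N D w)
      (fun F D g₀ os R => ∃ (h : Node00.IsDatumOfRecord₁₁C F N D) (ℓ : Λ' F), R = rc F h.params h.provisos ℓ g₀ os) := by
  intro F D w hR _ _
  have hD : Node00.IsDatumOfRecord₁₁C F N D := Node00.isDatumOfRecord₁₁C_of_isRecordOfRecord₁₁C hR
  obtain ⟨ℓ⟩ := hℓ F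
  exact T4ContinuumYM4Torus.ForSmallCouplings.of_forall fun g₀ os => ⟨rc F hD.params hD.provisos ℓ g₀ os, hD, ℓ, rfl⟩

/-- **THE §1 TEST AT A DATUM-KEYED HOME**: if the carrier map's `ne1` TAKES THE VALUE `⟨Unit, growingTower, 1⟩` at the canonical parameter of some datum of record
(e.g. a FREE `NE1pCarriers`-valued binder), `S_N14` is FALSE (`not_n14At_growing_one`). [folklore] -/
theorem not_s_N14_datumKey_of_hits_growing
    (hex : ∃ (F : T4Family) (D : Datum F N) (h : Node00.IsDatumOfRecord₁₁C F N D) (ℓ : Λ' F) (g₀ : ℕ → ℝ) (os : List (ULoop F)),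
      (rc F h.params h.provisos ℓ g₀ os).ne1 = ⟨Unit, growingTower, 1⟩) :
    ¬ S_N14 (fun F D g₀ os R => ∃ (h : Node00.IsDatumOfRecord₁₁C F N D) (ℓ : Λ' F), R = rc F h.params h.provisos ℓ g₀ os) := by
  rw [s_N14_datumKey_iff]
  obtain ⟨F, D, hD, ℓ, g₀, os, hne1⟩ := hex
  exact fun h => not_n14At_growing_one (hne1 ▸ h F D hD ℓ g₀ os)

/-- **N14's FINAL-SCALE PROFILE AT THE DATUM-KEYED OBJECT** (n14-a `finalProfile_of_n14`): what N19 reads at the canonical parameter. [folklore] -/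
theorem finalProfile_at_datumKey
    (h : S_N14 (fun F D g₀ os R => ∃ (h : Node00.IsDatumOfRecord₁₁C F N D) (ℓ : Λ' F), R = rc F h.params h.provisos ℓ g₀ os))
    {F : T4Family} {D : Datum F N} (hD : Node00.IsDatumOfRecord₁₁C F N D) (ℓ : Λ' F) (g₀ : ℕ → ℝ) (os : List (ULoop F)) :
    ∃ A₀ ρ : ℝ, 0 ≤ A₀ ∧ 0 ≤ ρ ∧ 0 ≤ (rc F hD.params hD.provisos ℓ g₀ os).ne1.Λ ∧ ρ * (rc F hD.params hD.provisos ℓ g₀ os).ne1.Λ < 1 ∧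
      ∀ (p : (rc F hD.params hD.provisos ℓ g₀ os).ne1.P) (K : ℕ) (b : ((rc F hD.params hD.provisos ℓ g₀ os).ne1.𝒯.B p K).Birth),
        ((rc F hD.params hD.provisos ℓ g₀ os).ne1.𝒯.B p K).size b K ≤
          A₀ * ρ ^ (K - ((rc F hD.params hD.provisos ℓ g₀ os).ne1.𝒯.B p K).birthScale b) :=
  finalProfile_of_n14 ((s_N14_datumKey_iff rc).1 h F D hD ℓ g₀ os)

end DatumKeyed

/-! ## §2 BY NAME AT LAYER B's `RRec₁₁ 𝔯` (dag-n22-e, p457330) — layer B's own face `s_N14_rRec₁₁_iff` says the K4 stub of N14 IS «NE1′ for the reading's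
dressed-tower assignment `𝔯.ne1` at the canonical parameter of every datum of record»; here: THE KNIT from the dressing estimate for `𝔯.ne1`, its slot form, the
independence from the Literature-typed objects `𝔯.lit`, the census' §1 test at the home with both ends of the residual design, N19's final-scale profile, and the
`canon₁₁` reading.  `𝔯.ne1` is RESIDUAL (layer B docstring): a skeleton quoting `S_N14 (RRec₁₁ 𝔯)` NAMES its `𝔯.ne1`; no N14 discharge over a residual reading -/

section AtRRec₁₁

variable (𝔯 : RateReading₁₁ N)

/-- **`RRec₁₁ 𝔯` IS THE DATUM-KEYED HOME OF §1** at the carrier map `fun F θ _ k g₀ os => rateCarriersOfRecord₁₁ 𝔯 F θ g₀ os k` (binder type `ℕ`, the run length;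
the provisos proof is not read) — definitionally (`Iff.rfl` pointwise), so every §1 face applies to layer B's predicate verbatim. [folklore] -/
theorem rRec₁₁_iff_datumKey {F : T4Family} (D : Datum F N) (g₀ : ℕ → ℝ) (os : List (ULoop F)) (R : RateCarriers N) :
    RRec₁₁ 𝔯 F D g₀ os R ↔
      ∃ (h : Node00.IsDatumOfRecord₁₁C F N D) (k : ℕ), R = (fun F (θ : Node00.Stage11Params F N) (_ : θ.Provisos₁₁) (k : ℕ) g₀ os =>
        rateCarriersOfRecord₁₁ 𝔯 F θ g₀ os k) F h.params h.provisos k g₀ os :=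
  Iff.rfl

/-- **THE KNIT OF THE ROW**: the dressing estimate for the reading's dressed-tower assignment at EVERY admissible Stage-11 parameter with provisos —
`∀ F θ, θ.Provisos₁₁ → θ.Admissible → ∀ g₀ os, N14At (𝔯.ne1 F θ g₀ os)` (n14-c's s1 target type; NODE O's object makes it contentful) — gives `S_N14 (RRec₁₁ 𝔯)`
(layer B's `s_N14_rRec₁₁_iff` + `IsDatumOfRecord₁₁C.provisos ∕ .admissible`). [folklore] -/
theorem s_N14_rRec₁₁_of_n14At
    (h : ∀ (F : T4Family) (θ : Node00.Stage11Params F N), θ.Provisos₁₁ → θ.Admissible →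
      ∀ (g₀ : ℕ → ℝ) (os : List (ULoop F)), N14At (𝔯.ne1 F θ g₀ os)) :
    S_N14 (RRec₁₁ 𝔯) :=
  (s_N14_rRec₁₁_iff 𝔯).2 fun F _ hD g₀ os => h F hD.params hD.provisos hD.admissible g₀ os

/-- **THE KNIT FROM THE SLOT**: uniform leaves for `𝔯.ne1`'s tower at its own rate, at every admissible parameter — ONE application of n14-a's
`n14At_of_uniformLeaves` (END-B `dressedStabilityStrict_of_bookingLeaves` by name). [folklore] -/
theorem s_N14_rRec₁₁_of_uniformLeaves
    (h : ∀ (F : T4Family) (θ : Node00.Stage11Params F N), θ.Provisos₁₁ → θ.Admissible →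
      ∀ (g₀ : ℕ → ℝ) (os : List (ULoop F)), ∃ U : UniformConstants, U.Λ = (𝔯.ne1 F θ g₀ os).Λ ∧
        ∀ p K, Nonempty (BookingLeaves U ((𝔯.ne1 F θ g₀ os).𝒯.B p K) ((𝔯.ne1 F θ g₀ os).𝒯.T p K))) :
    S_N14 (RRec₁₁ 𝔯) :=
  s_N14_rRec₁₁_of_n14At 𝔯 fun F θ hP hθ g₀ os => n14At_of_uniformLeaves _ (h F θ hP hθ g₀ os)

/-- **… and from ONE `U : UniformConstants` serving every admissible parameter** (n14-a's `s_N14_of_one` shape at the home: the K- and μ-free constants chosen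
BEFORE the family, the parameter, the run). [folklore] -/
theorem s_N14_rRec₁₁_of_one (U : UniformConstants)
    (hΛ : ∀ (F : T4Family) (θ : Node00.Stage11Params F N), θ.Provisos₁₁ → θ.Admissible →
      ∀ (g₀ : ℕ → ℝ) (os : List (ULoop F)), (𝔯.ne1 F θ g₀ os).Λ = U.Λ)
    (hL : ∀ (F : T4Family) (θ : Node00.Stage11Params F N), θ.Provisos₁₁ → θ.Admissible →
      ∀ (g₀ : ℕ → ℝ) (os : List (ULoop F)) (p : (𝔯.ne1 F θ g₀ os).P) (K : ℕ),
        Nonempty (BookingLeaves U ((𝔯.ne1 F θ g₀ os).𝒯.B p K) ((𝔯.ne1 F θ g₀ os).𝒯.T p K))) :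
    S_N14 (RRec₁₁ 𝔯) :=
  s_N14_rRec₁₁_of_uniformLeaves 𝔯 fun F θ hP hθ g₀ os => ⟨U, (hΛ F θ hP hθ g₀ os).symm, hL F θ hP hθ g₀ os⟩

/-- **`S_N14 (RRec₁₁ 𝔯)` DOES NOT READ THE LITERATURE-TYPED OBJECTS `𝔯.lit`**: two readings with the same dressed-tower assignment give the same N14 stub —
NOTHING of node U3's tower, N16's or N15's layers bears on N14 at the home (census §4 in the keyed setting). [folklore] -/
theorem s_N14_rRec₁₁_iff_of_ne1_eq (𝔯' : RateReading₁₁ N) (e : 𝔯.ne1 = 𝔯'.ne1) : S_N14 (RRec₁₁ 𝔯) ↔ S_N14 (RRec₁₁ 𝔯') := by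
  rw [s_N14_rRec₁₁_iff, s_N14_rRec₁₁_iff, e]

/-- **THE CENSUS' §1 TEST AT `RRec₁₁`**: a dressed-tower assignment taking the doubling-tower value `⟨Unit, growingTower, 1⟩` at the canonical parameter of ONE datum
of record refutes the stub (`not_n14At_growing_one`). [folklore] -/
theorem not_s_N14_rRec₁₁_of_hits_growing
    (hex : ∃ (F : T4Family) (D : Datum F N) (h : Node00.IsDatumOfRecord₁₁C F N D) (g₀ : ℕ → ℝ) (os : List (ULoop F)),
      𝔯.ne1 F h.params g₀ os = ⟨Unit, growingTower, 1⟩) :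
    ¬ S_N14 (RRec₁₁ 𝔯) := by
  rw [s_N14_rRec₁₁_iff]
  obtain ⟨F, D, hD, g₀, os, h𝔱⟩ := hex
  exact fun h => not_n14At_growing_one (h𝔱 ▸ h F D hD g₀ os)

/-- … in particular the reading whose dressed-tower assignment is the CONSTANT doubling tower is refuted as soon as some datum is of record (the route's K0
`Record11Inhabited` at `N = 2` gives one via `Node00.isDatumOfRecord₁₁C_of_isRecordOfRecord₁₁C`) — a FREE∕unpinned `ne1` can never be `--split` over. [folklore] -/
theorem not_s_N14_rRec₁₁_growing (hex : ∃ (F : T4Family) (D : Datum F N), Node00.IsDatumOfRecord₁₁C F N D) :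
    ¬ S_N14 (RRec₁₁ { 𝔯 with ne1 := fun _ _ _ _ => ⟨Unit, growingTower, 1⟩ }) := by
  obtain ⟨F, D, hD⟩ := hex
  exact not_s_N14_rRec₁₁_of_hits_growing _ ⟨F, D, hD, fun _ => 0, [], rfl⟩

/-- … at a Stage-11 RECORD `(D, w)` the same (the record-level form the K3 text speaks). [folklore] -/
theorem not_s_N14_rRec₁₁_growing_of_isRecordOfRecord₁₁C {F : T4Family} {D : Datum F N} {w : DagBinding.WorldP}
    (hR : Node00.IsRecordOfRecord₁₁C F N D w) :
    ¬ S_N14 (RRec₁₁ { 𝔯 with ne1 := fun _ _ _ _ => ⟨Unit, growingTower, 1⟩ }) :=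
  not_s_N14_rRec₁₁_growing 𝔯 ⟨F, D, Node00.isDatumOfRecord₁₁C_of_isRecordOfRecord₁₁C hR⟩

/-- … while the reading whose dressed-tower assignment is the CONSTANT TOY tower closes the stub with NO content about Bałaban's run (`n14At_toyTower`): the
junk end of the residual design, in kernel. [folklore] -/
theorem s_N14_rRec₁₁_toy : S_N14 (RRec₁₁ { 𝔯 with ne1 := fun _ _ _ _ => ⟨Unit, toyTower, 2⟩ }) :=
  (s_N14_rRec₁₁_iff _).2 fun _ _ _ _ _ => n14At_toyTower

/-- **BOTH ENDS AT ONCE**: given one datum of record, the N14 stub at `RRec₁₁` is neither always true nor always false across readings — it is a statement ABOUT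
`𝔯.ne1`, decided by the dressing estimate for that object and by nothing in the home. [folklore] -/
theorem s_N14_rRec₁₁_depends_on_ne1 (hex : ∃ (F : T4Family) (D : Datum F N), Node00.IsDatumOfRecord₁₁C F N D) :
    S_N14 (RRec₁₁ { 𝔯 with ne1 := fun _ _ _ _ => ⟨Unit, toyTower, 2⟩ }) ∧
      ¬ S_N14 (RRec₁₁ { 𝔯 with ne1 := fun _ _ _ _ => ⟨Unit, growingTower, 1⟩ }) :=
  ⟨s_N14_rRec₁₁_toy 𝔯, not_s_N14_rRec₁₁_growing 𝔯 hex⟩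

/-- **N19's FACE AT `RRec₁₁`: THE FINAL-SCALE PROFILE of `𝔯.ne1`'s tower at the canonical parameter** (letter `ρ·Λ < 1`, `size b K ≤ A₀ρ^{K−j}`; n14-a's
`finalProfile_of_n14`). [folklore] -/
theorem finalProfile_at_rRec₁₁ (h : S_N14 (RRec₁₁ 𝔯)) {F : T4Family} {D : Datum F N} (hD : Node00.IsDatumOfRecord₁₁C F N D)
    (g₀ : ℕ → ℝ) (os : List (ULoop F)) :
    ∃ A₀ ρ : ℝ, 0 ≤ A₀ ∧ 0 ≤ ρ ∧ 0 ≤ (𝔯.ne1 F hD.params g₀ os).Λ ∧ ρ * (𝔯.ne1 F hD.params g₀ os).Λ < 1 ∧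
      ∀ (p : (𝔯.ne1 F hD.params g₀ os).P) (K : ℕ) (b : ((𝔯.ne1 F hD.params g₀ os).𝒯.B p K).Birth),
        ((𝔯.ne1 F hD.params g₀ os).𝒯.B p K).size b K ≤ A₀ * ρ ^ (K - ((𝔯.ne1 F hD.params g₀ os).𝒯.B p K).birthScale b) :=
  finalProfile_of_n14 ((s_N14_rRec₁₁_iff 𝔯).1 h F D hD g₀ os)

/-- **THE WEAK HEADLINE AT THE HOME** (venue `N14weak`): under the stub, `DressedStability (𝔯.ne1 F h.params g₀ os).𝒯` at every datum of record
(`dressedStability_of_strict`). [folklore] -/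
theorem dressedStability_at_rRec₁₁ (h : S_N14 (RRec₁₁ 𝔯)) {F : T4Family} {D : Datum F N} (hD : Node00.IsDatumOfRecord₁₁C F N D)
    (g₀ : ℕ → ℝ) (os : List (ULoop F)) : DressedStability (𝔯.ne1 F hD.params g₀ os).𝒯 :=
  dressedStability_of_strict ((s_N14_rRec₁₁_iff 𝔯).1 h F D hD g₀ os)

/-- **AT AN ADMISSIBLE PARAMETER the stub gives NE1′ for `𝔯.ne1` read THROUGH `Node00.canon₁₁`** (the canonical parameter of `θ`'s own datum;
`Node00.canon₁₁_eq_of_admissible`) — the form in which a θ-level consumer meets the datum key; at `θ` itself nothing follows unless `𝔯.ne1` respects the datum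
(`(isDatumOfRecord₁₁C_datumOfRecord₁₁ θ hP hθ).params` is SOME parameter with the same datum, by design of the key). [folklore] -/
theorem n14At_canon_of_s_N14_rRec₁₁ (h : S_N14 (RRec₁₁ 𝔯)) {F : T4Family} (θ : Node00.Stage11Params F N) (hP : θ.Provisos₁₁)
    (hθ : θ.Admissible) (g₀ : ℕ → ℝ) (os : List (ULoop F)) :
    N14At (Node00.canon₁₁ F N (fun θ' _ => 𝔯.ne1 F θ') θ hP g₀ os) := by
  rw [Node00.canon₁₁_eq_of_admissible θ hP hθ]
  exact (s_N14_rRec₁₁_iff 𝔯).1 h F _ (Node00.isDatumOfRecord₁₁C_datumOfRecord₁₁ F N θ hP hθ) g₀ os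

/-- **K4's `RatesAt` AT THE HOME READS N14 AT `𝔯.ne1`**: whatever level `k` the join admits, the N14 conjunct of `RatesAt D (rateCarriersOfRecord₁₁ 𝔯 F h.params g₀ os k)`
is `N14At (𝔯.ne1 F h.params g₀ os)` — level-free (`Iff.rfl` on the first conjunct). [folklore] -/
theorem ratesAt_rateCarriersOfRecord₁₁_n14 {F : T4Family} {D : Datum F N} (hD : Node00.IsDatumOfRecord₁₁C F N D) (g₀ : ℕ → ℝ)
    (os : List (ULoop F)) (k : ℕ) (h : RatesAt D (rateCarriersOfRecord₁₁ 𝔯 F hD.params g₀ os k)) : N14At (𝔯.ne1 F hD.params g₀ os) :=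
  h.1

end AtRRec₁₁

end YMDAG.N14

end
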